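import Mathlib
import Summits.Ventures.DiscreteObjects.Mahler.SalemSignCertificate
import Summits.Ventures.DiscreteObjects.Mahler.CensusData10to18

/-!
# Kernel certificates for the degree-14 height-1 Salem cores `c14_02`, `c14_03`, `c14_05` (venture `DiscreteObjects`, target L)

Cell `pub-namedobj`, seat `pub-namedobj-mahler` (gen 10). Framing: lottery ticket; floor = certified
bounds/negative ranges.

Third-engine (kernel) certification of census cores via the sign-data wrapper `salem_certificate_of_signs`: of the
eleven degree-14 height-1 cores (`CensusData10to18.coresDeg14`), five are Salem polynomials: `c14_01` is the MRW Table-1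
minimiser (`mrwPoly14`, kernel enclosure `MRWDegree14Measure`), and `c14_02`, `c14_03`, `c14_05` are certified here
(`1.20261674…`, `1.25509351…`, `1.26729644…` — small Salem numbers of degree 14); the others have complex trace roots.
-/

namespace Summit.Ventures.DiscreteObjects.Mahler

open Polynomial

/-- `traceLift` of the trace polynomial of `c14_02` is the core `c14_02`. -/
theorem traceLift_c14_02 : traceLift (X ^ 7 - C 8 * X ^ 5 + C 19 * X ^ 3 - C 12 * X - 1 : ℤ[X]) = ofCoeffs c14_02 := by
  have hdeg : (X ^ 7 - C 8 * X ^ 5 + C 19 * X ^ 3 - C 12 * X - 1 : ℤ[X]).natDegree = 7 := by compute_degree!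
  have hP : ofCoeffs c14_02 = (X ^ 14 - X ^ 12 - X ^ 7 - X ^ 2 + 1 : ℤ[X]) := by
    unfold ofCoeffs c14_02; simp [List.zipIdx]; ring
  rw [hP, traceLift, hdeg]
  simp only [Finset.sum_range_succ, Finset.sum_range_zero, zero_add, coeff_add, coeff_sub, coeff_X_pow,
    coeff_C_mul, coeff_X, coeff_one]
  norm_num
  ring

/-- **`1.20261674 < M(c14_02) < 1.20261675`** — a degree-14 Salem number (height-1 census core). -/
theorem c14_02_measure_enclosure :
    (120261674 / 10 ^ 8 : ℝ) < intMahlerMeasure (ofCoeffs c14_02) ∧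
      intMahlerMeasure (ofCoeffs c14_02) < 120261675 / 10 ^ 8 := by
  set Q : ℤ[X] := X ^ 7 - C 8 * X ^ 5 + C 19 * X ^ 3 - C 12 * X - 1 with hQdef
  have hQmonic : Q.Monic := by rw [hQdef]; monicity!
  have hQdeg : Q.natDegree = 7 := by rw [hQdef]; compute_degree!
  have hev : ∀ y : ℝ, aeval y Q = y ^ 7 - 8 * y ^ 5 + 19 * y ^ 3 - 12 * y - 1 := by
    intro y
    rw [hQdef]
    simp only [map_add, map_sub, map_mul, map_pow, aeval_X, map_ofNat, map_one]
  set c₁ : ℝ := 120261674 / 10 ^ 8 with hc₁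
  set c₂ : ℝ := 120261675 / 10 ^ 8 with hc₂
  obtain ⟨y, hya, hyb, hM1, hMM⟩ := salem_certificate_of_signs hQmonic
    [-2, -19/10, -1, -1/2, 0, 3/2, 2] (by rw [hQdeg]; rfl)
    (by simp only [List.isChain_cons_cons, List.isChain_singleton, and_true]; norm_num)
    (by intro p hp; simp only [List.mem_cons, List.mem_nil_iff, or_false] at hp
        rcases hp with rfl | rfl | rfl | rfl | rfl | rfl | rfl <;> norm_num)
    (by simp only [List.isChain_cons_cons, List.isChain_singleton, and_true, hev]; norm_num)
    (a := c₁ + c₁⁻¹) (b := c₂ + c₂⁻¹) (by rw [hc₁, hc₂]; norm_num)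
    (Or.inr (by rw [hc₁]; norm_num)) (by rw [hev, hev, hc₁, hc₂]; norm_num)
  rw [traceLift_c14_02] at hM1 hMM
  have hc1y : 2 < c₁ + c₁⁻¹ := by rw [hc₁]; norm_num
  rw [abs_of_pos (by linarith)] at hMM
  have hMpos : 0 < intMahlerMeasure (ofCoeffs c14_02) := by linarith
  constructor
  · have h : c₁ + c₁⁻¹ < intMahlerMeasure (ofCoeffs c14_02) + (intMahlerMeasure (ofCoeffs c14_02))⁻¹ := by
      rw [hMM]; linarith
    exact lt_of_add_inv_lt_add_inv hM1.le (by rw [hc₁]; norm_num) h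
  · have h : intMahlerMeasure (ofCoeffs c14_02) + (intMahlerMeasure (ofCoeffs c14_02))⁻¹ < c₂ + c₂⁻¹ := by
      rw [hMM]; linarith
    exact lt_of_add_inv_lt_add_inv (by rw [hc₂]; norm_num) hMpos h

/-- `traceLift` of the trace polynomial of `c14_03` is the core `c14_03`. -/
theorem traceLift_c14_03 : traceLift (X ^ 7 - C 8 * X ^ 5 - X ^ 4 + C 19 * X ^ 3 + C 5 * X ^ 2 - C 12 * X - C 5 : ℤ[X]) = ofCoeffs c14_03 := by
  have hdeg : (X ^ 7 - C 8 * X ^ 5 - X ^ 4 + C 19 * X ^ 3 + C 5 * X ^ 2 - C 12 * X - C 5 : ℤ[X]).natDegree = 7 := by compute_degree!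
  have hP : ofCoeffs c14_03 = (X ^ 14 - X ^ 12 - X ^ 11 + X ^ 9 - X ^ 7 + X ^ 5 - X ^ 3 - X ^ 2 + 1 : ℤ[X]) := by
    unfold ofCoeffs c14_03; simp [List.zipIdx]; ring
  rw [hP, traceLift, hdeg]
  simp only [Finset.sum_range_succ, Finset.sum_range_zero, zero_add, coeff_add, coeff_sub, coeff_X_pow,
    coeff_C_mul, coeff_X]
  norm_num
  ring

/-- **`1.25509351 < M(c14_03) < 1.25509352`** — a degree-14 Salem number (height-1 census core). -/
theorem c14_03_measure_enclosure :
    (125509351 / 10 ^ 8 : ℝ) < intMahlerMeasure (ofCoeffs c14_03) ∧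
      intMahlerMeasure (ofCoeffs c14_03) < 125509352 / 10 ^ 8 := by
  set Q : ℤ[X] := X ^ 7 - C 8 * X ^ 5 - X ^ 4 + C 19 * X ^ 3 + C 5 * X ^ 2 - C 12 * X - C 5 with hQdef
  have hQmonic : Q.Monic := by rw [hQdef]; monicity!
  have hQdeg : Q.natDegree = 7 := by rw [hQdef]; compute_degree!
  have hev : ∀ y : ℝ, aeval y Q = y ^ 7 - 8 * y ^ 5 - y ^ 4 + 19 * y ^ 3 + 5 * y ^ 2 - 12 * y - 5 := by
    intro y
    rw [hQdef]
    simp only [map_add, map_sub, map_mul, map_pow, aeval_X, map_ofNat]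
  set c₁ : ℝ := 125509351 / 10 ^ 8 with hc₁
  set c₂ : ℝ := 125509352 / 10 ^ 8 with hc₂
  obtain ⟨y, hya, hyb, hM1, hMM⟩ := salem_certificate_of_signs hQmonic
    [-2, -7/4, -1, -1/2, 0, 3/2, 2] (by rw [hQdeg]; rfl)
    (by simp only [List.isChain_cons_cons, List.isChain_singleton, and_true]; norm_num)
    (by intro p hp; simp only [List.mem_cons, List.mem_nil_iff, or_false] at hp
        rcases hp with rfl | rfl | rfl | rfl | rfl | rfl | rfl <;> norm_num)
    (by simp only [List.isChain_cons_cons, List.isChain_singleton, and_true, hev]; norm_num)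
    (a := c₁ + c₁⁻¹) (b := c₂ + c₂⁻¹) (by rw [hc₁, hc₂]; norm_num)
    (Or.inr (by rw [hc₁]; norm_num)) (by rw [hev, hev, hc₁, hc₂]; norm_num)
  rw [traceLift_c14_03] at hM1 hMM
  have hc1y : 2 < c₁ + c₁⁻¹ := by rw [hc₁]; norm_num
  rw [abs_of_pos (by linarith)] at hMM
  have hMpos : 0 < intMahlerMeasure (ofCoeffs c14_03) := by linarith
  constructor
  · have h : c₁ + c₁⁻¹ < intMahlerMeasure (ofCoeffs c14_03) + (intMahlerMeasure (ofCoeffs c14_03))⁻¹ := by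
      rw [hMM]; linarith
    exact lt_of_add_inv_lt_add_inv hM1.le (by rw [hc₁]; norm_num) h
  · have h : intMahlerMeasure (ofCoeffs c14_03) + (intMahlerMeasure (ofCoeffs c14_03))⁻¹ < c₂ + c₂⁻¹ := by
      rw [hMM]; linarith
    exact lt_of_add_inv_lt_add_inv (by rw [hc₂]; norm_num) hMpos h

/-- `traceLift` of the trace polynomial of `c14_05` is the core `c14_05`. -/
theorem traceLift_c14_05 : traceLift (X ^ 7 - X ^ 6 - C 7 * X ^ 5 + C 6 * X ^ 4 + C 14 * X ^ 3 - C 9 * X ^ 2 - C 8 * X + C 3 : ℤ[X]) = ofCoeffs c14_05 := by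
  have hdeg : (X ^ 7 - X ^ 6 - C 7 * X ^ 5 + C 6 * X ^ 4 + C 14 * X ^ 3 - C 9 * X ^ 2 - C 8 * X + C 3 : ℤ[X]).natDegree = 7 := by compute_degree!
  have hP : ofCoeffs c14_05 = (X ^ 14 - X ^ 13 - X ^ 8 + X ^ 7 - X ^ 6 - X + 1 : ℤ[X]) := by
    unfold ofCoeffs c14_05; simp [List.zipIdx]; ring
  rw [hP, traceLift, hdeg]
  simp only [Finset.sum_range_succ, Finset.sum_range_zero, zero_add, coeff_add, coeff_sub, coeff_X_pow,
    coeff_C_mul, coeff_X]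
  norm_num
  ring

/-- **`1.26729644 < M(c14_05) < 1.26729645`** — a degree-14 Salem number (height-1 census core). -/
theorem c14_05_measure_enclosure :
    (126729644 / 10 ^ 8 : ℝ) < intMahlerMeasure (ofCoeffs c14_05) ∧
      intMahlerMeasure (ofCoeffs c14_05) < 126729645 / 10 ^ 8 := by
  set Q : ℤ[X] := X ^ 7 - X ^ 6 - C 7 * X ^ 5 + C 6 * X ^ 4 + C 14 * X ^ 3 - C 9 * X ^ 2 - C 8 * X + C 3 with hQdef
  have hQmonic : Q.Monic := by rw [hQdef]; monicity!
  have hQdeg : Q.natDegree = 7 := by rw [hQdef]; compute_degree!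
  have hev : ∀ y : ℝ, aeval y Q = y ^ 7 - y ^ 6 - 7 * y ^ 5 + 6 * y ^ 4 + 14 * y ^ 3 - 9 * y ^ 2 - 8 * y + 3 := by
    intro y
    rw [hQdef]
    simp only [map_add, map_sub, map_mul, map_pow, aeval_X, map_ofNat]
  set c₁ : ℝ := 126729644 / 10 ^ 8 with hc₁
  set c₂ : ℝ := 126729645 / 10 ^ 8 with hc₂
  obtain ⟨y, hya, hyb, hM1, hMM⟩ := salem_certificate_of_signs hQmonic
    [-2, -3/2, -1, 0, 1, 3/2, 2] (by rw [hQdeg]; rfl)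
    (by simp only [List.isChain_cons_cons, List.isChain_singleton, and_true]; norm_num)
    (by intro p hp; simp only [List.mem_cons, List.mem_nil_iff, or_false] at hp
        rcases hp with rfl | rfl | rfl | rfl | rfl | rfl | rfl <;> norm_num)
    (by simp only [List.isChain_cons_cons, List.isChain_singleton, and_true, hev]; norm_num)
    (a := c₁ + c₁⁻¹) (b := c₂ + c₂⁻¹) (by rw [hc₁, hc₂]; norm_num)
    (Or.inr (by rw [hc₁]; norm_num)) (by rw [hev, hev, hc₁, hc₂]; norm_num)
  rw [traceLift_c14_05] at hM1 hMM
  have hc1y : 2 < c₁ + c₁⁻¹ := by rw [hc₁]; norm_num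
  rw [abs_of_pos (by linarith)] at hMM
  have hMpos : 0 < intMahlerMeasure (ofCoeffs c14_05) := by linarith
  constructor
  · have h : c₁ + c₁⁻¹ < intMahlerMeasure (ofCoeffs c14_05) + (intMahlerMeasure (ofCoeffs c14_05))⁻¹ := by
      rw [hMM]; linarith
    exact lt_of_add_inv_lt_add_inv hM1.le (by rw [hc₁]; norm_num) h
  · have h : intMahlerMeasure (ofCoeffs c14_05) + (intMahlerMeasure (ofCoeffs c14_05))⁻¹ < c₂ + c₂⁻¹ := by
      rw [hMM]; linarith
    exact lt_of_add_inv_lt_add_inv (by rw [hc₂]; norm_num) hMpos h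

end Summit.Ventures.DiscreteObjects.Mahler
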